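import Literature.NumberTheory.LFunctions.Zhang2022.RepairRplusPlus4
import Literature.NumberTheory.LFunctions.Zhang2022.RepairRplusPlus5
import Literature.NumberTheory.LFunctions.Zhang2022.RepairRplusPlus6
import Literature.NumberTheory.LFunctions.Zhang2022.RepairRplusPlus7
import Literature.NumberTheory.LFunctions.Zhang2022.DetectorEntangledConePSD
import Literature.NumberTheory.LFunctions.Zhang2022.RepairIntakeBfam
import Literature.NumberTheory.LFunctions.Zhang2022.DHMenuConsistentInformal
import Literature.NumberTheory.LFunctions.Zhang2022.DHMenuConsistentProof
import Literature.NumberTheory.LFunctions.Zhang2022.DHMenuConsistentPrimesProof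

/-!
# Zhang (2022) §18-margin repair rung — THE DONE-CONDITION OF SUB-CELL E IN ONE DECLARATION (`Repair.doneCondition_v10`)

Trunk T-ANT (NumberTheory/LFunctions). Y. Zhang, *Discrete mean estimates and the Landau–Siegel zero*,
arXiv:2211.02515v1 (2022) [Zhang2022LandauSiegel] — **an unrefereed manuscript under adjudication. WHAT THIS IS NOT:
nothing here asserts or denies its Theorems 1–2 or any analytic lemma; no claim about Landau–Siegel zeros, about
Parity, or about a repaired `Margin232` is made. The programme SEARCHES and TYPES; no claim about Landau–Siegel
zeros, Theorems 1–2 of arXiv:2211.02515 or a repaired Margin232 until a kernel theorem says so.** Cell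
`landau-siegel` (rung F-S3), sub-cell E (barrier extension), seat ls-barrier-p5 (generation g3), stub **S-E-p5-5** of
barrier/ASSIGNMENTS.md (ls-barrier-plan g1 rulings 2026-08-26T22:20:20Z (3) and 22:26:24Z (2): «the §6 D1 KERNEL
SENTENCE OF RECORD IN ONE DECL», class of record `Repair.Rplusplus10`, p471073).

## What this file is

ONE theorem, `Repair.doneCondition_v10`, and nothing else of substance: the CONJUNCTION of three kernel facts that are
already in the tree, each cited BY NAME (no new `Prop`, no new family, no restatement, nothing re-proved):

1. `Repair.rplusplus10_decided : ClassDecided Rplusplus10` (RepairRplusPlus4.lean, p471073) — every one of the 36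
   design families of the class of record is DECIDED: for each design in the family's class `K`, the family's verdict
   «no closing of Zhang's endgame at main order» holds in the family's declared currency, with every E*-strength
   input DISPLAYED as a hypothesis of the verdict (never asserted);
2. `Repair.rplusplus10_words_sub : (∀ F ∈ bmultiWord6, F ∈ Rplusplus10) ∧ (∀ F ∈ blenWord3, F ∈ Rplusplus10)`
   (RepairRplusPlus4.lean) — the two DESIGN-CLASS KILL words intaken so far (B-multi: `Repair.bmultiWord6`,
   RepairIntakeBmulti p469194; B-len: `Repair.blenWord3`, RepairIntakeBlen p470514) are sub-lists of the class of
   record;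
3. `Zhang2022.DH.menuConsistent_holds : DH.MenuConsistent` (DHMenuConsistentProof.lean, p468827; REF-E E-18 PASS)
   — the CONSISTENCY-MODEL KILL word B-dh: Zhang's deduced menu `M_typed` is consistent in the model world
   `W(D, χ)` BY THEOREM (E-057 discharged, no hypothesis).

Versioning (planner 22:34:58Z): the decl name carries the WORD content, not the class version — `doneCondition_v10`
stays on `Rplusplus10`; `doneCondition_v11` is appended (never restated) only when a WORD clause is added
(`ClassDecided Repair.bfamWord` at INTAKE-3; `DH.MenuConsistentPrimes` at E-18b; `DH.MenuInformalConsistent` at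
E-18c), citing the then class of record.

## The done-sentence this declaration serves (charter LS-PROGRAMME.md v1.1 ea19a413406b3e92, §2 row E, VERBATIM)

«keep = one theorem per 24 h; **done** when R⁺⁺ covers every killed family ⇒ the programme's fallback deliverable
«no design in R⁺⁺ eliminates the Siegel zero by this endgame without an estimate of E*-strength» is a kernel
theorem + referee bundle».

## The shape of record (HOME/ls-barrier-plan/KILL-INTAKE.md v1.11 850c458981133b11 §6, VERBATIM: D1, D1′, D2, D4)

(D1) KERNEL THEOREM OF RECORD = the last `Repair.Rplusplus<k>` / `rplusplus<k>_decided` (RepairRplusPlus2.lean,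
p1) whose table docstring lists, per row: §B word ↦ sub-class ↦ family ↦ currency ↦ displayed slot(s) = the
E*-strength estimate(s) by EDREGISTRY id (analytic E-row, open/derivation) or WORLD binder (inhabited ∧
load-bearing decl) ↦ referee entry E-n; plus one `RepairIntake<Fam>.lean` per KILL word (word verbatim, C1) whose
list ⊆ Rplusplus<k> (`mem_rplusplusN_iff`). «Without an estimate of E*-strength» is made precise row by row: the
Verdict is `K d → (displayed slots) → ¬ closes d`, and every displayed ANALYTIC slot is an E-row priced ≥ M by
ls-ref-1 — the theorem never asserts a slot.

(D1′, added 21:44Z g1) PER-WORD SHAPE BY WORD TYPE — the «one RepairIntake<Fam>.lean per KILL word whose list ⊆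
Rplusplus<k>» clause of D1 applies to DESIGN-CLASS words (B-multi: `bmultiWord6` p469194 ⊆ Rplusplus8; B-len:
`blenWord2`/`blenWord3` ⊆ Rplusplus8; B-det when issued: `bdetWord` dispatching to familyDetShift/familyH1 ⊆
Rplusplus<k>); for the CONSISTENCY-MODEL word B-dh the deliverable is the named theorem
`Zhang2022.DH.menuConsistent_holds : MenuConsistent` (E-18 PASS, p468827 — MET 21:17:06Z; M_typed UNCONDITIONAL)
plus `menuConsistentPrimes_holds` (E-18b) for the M_primes extension, recorded in BARRIER-STATE §2/§3 as «decided
in the consistency-model currency, not a DesignFamily row»; for the ENDGAME word B-fam the deliverable is the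
SEPARATE decided class `Repair.bfamWord` / `familyBfam_decided` (INTAKE-3; statuses (I) by theorem, (II-a) GIVEN
displayed binders of record, (II-b) GIVEN B-AH(fam) UNREVIEWED), «disjoint by declaration» from Rplusplus<k> and
never counted in its row arithmetic. The done-sentence of charter §2 row E is then asserted as: «every §B-killed
DESIGN class is inside Rplusplus<k> (kernel: `*_sub_rplusplus<k>`), the B-dh menu is consistent BY THEOREM, and
the B-fam endgame class is decided BY THEOREM / GIVEN displayed inputs in its own class» — three kernel facts +
the referee bundle, with D2's not-covered ledger alongside. [status clauses 22:11Z / 22:22Z / 22:28Z of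
KILL-INTAKE.md v1.11: design-class clause MET IN KERNEL; B-dh clause MET (E-18 PASS, p468827); B-fam clause
PENDING (INTAKE-3); class of record `Rplusplus10` p471073 (36 rows) with `rplusplus10_words_sub : bmultiWord6 ⊆
Rplusplus10 ∧ blenWord3 ⊆ Rplusplus10`; D1 decl of record = `Repair.doneCondition_v10` (S-E-p5-5);
`doneCondition_v11` appends `ClassDecided bfamWord` (INTAKE-3) and `DH.MenuConsistentPrimes` (E-18b) [and
`DH.MenuInformalConsistent` (E-18c) if landed].]

(D2) NOT-COVERED LEDGER (honesty clause, part of the deliverable): BARRIER-STATE §2 = thresholds T-1…T-4 (exact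
«closes iff» sentences), SEAM entries, the independence theorem for «lengths ≥ P» (S-E-p1-8; consistency-model
currency), the consistency-model theorem for B-dh (`DH.MenuConsistent`), and the UNCOVERED sub-words (literal
amplitude readings, (c)-door, exits x1–x3, two-sided detectors, B-ell in derivation currency) — each named with
its EDREGISTRY row; the done-sentence is asserted ONLY over R⁺⁺'s rows, never over these.

(D4) What it is NOT: not a claim that K_multi/K_len/… are decided in the true discrete-mean currency (only R, R̄
and the far/smooth invisibility rows are); not a claim about Landau–Siegel zeros; the model-currency rows rest on
B-AH / E-014 by premise (director 18:15:06Z).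

THE NOT-COVERED LEDGER (D2) IS NAMED HERE BY POINTER ONLY — barrier/BARRIER-STATE.md §2 (thresholds T-1…T-5, SEAM-1,
`Repair.lengthsBeyondP_independent`, the uncovered sub-words u1–u7 of RepairIntakeBlen, the B-det / B-ell items) — and
NOTHING in it is asserted or denied by `doneCondition_v10`.

## The four §B KILL words of record at this version (stamps; BARRIER-STATE §3)

* B-multi — director-frontier g5 2026-08-26T18:10:26Z, AMENDED 18:15:06Z (premise of record B-AH / E-014); text
  B-multi KILL-CERT v2.4 96c2304f42278a63; intake `Repair.bmultiWord6` (RepairIntakeBmulti, p469194; REF-E INTAKE-1).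
* B-len — ls-lead g0 2026-08-26T19:19:33Z under director-frontier pre-authorisation 18:53:49Z; text
  B-len/KILL-draft.md v2.4 b46628540b6b957c §1; intake `Repair.blenWord3` (RepairIntakeBlen, p470514; REF-E INTAKE-2).
* B-dh — director-frontier g6 2026-08-26T19:31:07Z (ls-lead OF RECORD 19:31:32Z); text B-dh/KILL-draft.md v1.4.5
  3fef880895ed21b9 §1; §E object `Zhang2022.DH.menuConsistent_holds` (p468827; REF-E E-18 PASS 21:28:44Z) —
  conjunct 3 below; the M_primes extension `DH.MenuConsistentPrimes` (E-18b) is NOT a conjunct of this version.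
* B-fam — WORD ISSUED director-frontier g6 2026-08-26T20:55:00Z, OF RECORD 21:15:26Z (stamps (i) ls-Bfam-plan
  20:59:55Z, (ii) REF-B3 21:15:26Z); text B-fam/KILL-draft.md v2.2.2 06cd652c2917c102 (§1 817b59c08b1564d9, §2
  class b6c520d7224008a5); §E object `Repair.bfamWord` (RepairIntakeBfam, INTAKE-3, PENDING) — NOT a conjunct of
  this version.
* B-det, B-ell — no word (live until the 2026-08-27T08:10:06Z keep/kill); B-ell enters §E in derivation currency only.

## References

* Y. Zhang, arXiv:2211.02515v1 (2022), §2 Lemma 2.3, Props. 2.2, 2.4–2.6, (2.16)–(2.20), (2.32)–(2.33) [pp. 4–11],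
  §7 Prop. 7.1 (7.2) [p. 44], §18 (18.9)–(18.12) [pp. 95–98]. [cite: Zhang2022LandauSiegel, §§2, 7, 18]
-/

noncomputable section

namespace Literature.NumberTheory.LFunctions.Zhang2022

namespace Repair

/-- **THE DONE-CONDITION OF SUB-CELL E, version 10 (D1 decl of record).** The conjunction of the three kernel
facts of record, each cited by name: (1) the class of record `Rplusplus10` (36 design families fed to Zhang's
main-term calculus or to a displayed model main term) is DECIDED — every family's verdict «no closing of the
§2/§18 endgame at main order without the DISPLAYED E*-strength input» holds on its whole class
(`rplusplus10_decided`); (2) the intake lists of the two design-class KILL words, `bmultiWord6` (B-multi) and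
`blenWord3` (B-len), are sub-lists of `Rplusplus10` (`rplusplus10_words_sub`); (3) the B-dh consistency-model word:
`DH.MenuConsistent` holds BY THEOREM (`DH.menuConsistent_holds`, E-057 discharged). Nothing is asserted about the
not-covered ledger (BARRIER-STATE §2), about `Repair.bfamWord` (INTAKE-3) or `DH.MenuConsistentPrimes` (E-18b) —
those are the clauses of `doneCondition_v11` —, and nothing about zeros of `L`-functions.
[cite: Zhang2022LandauSiegel, §2 (2.32)–(2.33); §7 Prop 7.1 (7.2); §18 (18.9)–(18.12)] -/
theorem doneCondition_v10 :
    ClassDecided Rplusplus10 ∧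
      ((∀ F ∈ bmultiWord6, F ∈ Rplusplus10) ∧ (∀ F ∈ blenWord3, F ∈ Rplusplus10)) ∧
      DH.MenuConsistent :=
  ⟨rplusplus10_decided, rplusplus10_words_sub, DH.menuConsistent_holds⟩

/-- Read-back of conjunct (3) at a datum (conjuncts (1)–(2) read back as `ClassDecided (bmultiWord6 ++ blenWord3)` are
exactly the landed `rplusplus9_decided_words`, RepairRplusPlus4.lean — not restated here): for every modulus `D` with `log D ≥ 43 250` and every primitive quadratic
`χ ≠ 1` mod `D`, the model world `W(D, χ)` satisfies the whole rendered menu — `doneCondition_v10` instantiated,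
nothing more. [cite: Zhang2022LandauSiegel, §2 Assumption (A)] -/
theorem doneCondition_v10_menu {D : ℕ} [NeZero D] (χ : DirichletCharacter ℂ D) (hprim : χ.IsPrimitive)
    (hquad : χ.IsQuadratic) (hne : χ ≠ 1) (hL : (43250 : ℝ) ≤ Real.log D) :
    (DH.world D χ).Menu D χ :=
  doneCondition_v10.2.2 D χ hprim hquad hne hL

/-! ### Version 11 (ls-barrier-plan g1 RE-POINT 2026-08-26T23:15:20Z: a WORD clause was added — E-18b
`DH.menuConsistentPrimes_holds` p473947 — AND the class of record moved to `Rplusplus11` p473293, so the decl takes both;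
append-only, `doneCondition_v10` above stays as landed, p473054, REF-E D1-1 PASS 23:24:21Z).

ERRATUM NOTE carried for the record (REF-E verdict 35 (1), 23:24:21Z): in the KILL-INTAKE.md v1.11 §6 D1′ text quoted
VERBATIM in the module docstring, the fragment «B-len: `blenWord2`/`blenWord3` ⊆ Rplusplus8» is not a tree fact for
`blenWord3` (its row 34 `familyNuLipOverhangAll` enters at `Rplusplus9`: `blenWord3_sub_rplusplus9`); the declarations
of this file cite `Rplusplus10` / `Rplusplus11` and are unaffected. -/

/-- **THE DONE-CONDITION OF SUB-CELL E, version 11 (D1 decl of record from 2026-08-26T23:15:20Z).** The conjunction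
of the kernel facts of record, each cited by name: (1) the class of record `Rplusplus11` (38 design families, p473293)
is DECIDED (`rplusplus11_decided`); (2) the intake lists of the two design-class KILL words, `bmultiWord6` (B-multi)
and `blenWord3` (B-len), are sub-lists of `Rplusplus11` (`rplusplus11_words_sub`); (3) the B-dh consistency-model
word on `M_typed ∪ M_primes`, UNCONDITIONAL: `DH.MenuConsistent` (`DH.menuConsistent_holds`, p468827, E-18) AND
`DH.MenuConsistentPrimes` (`DH.menuConsistentPrimes_holds`, p473947, E-18b) hold BY THEOREM. Nothing is asserted
about the not-covered ledger (BARRIER-STATE §2), about `Repair.bfamWord` (INTAKE-3, p474295 — the clause of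
`doneCondition_v12` together with the B-det intake class `Rplusplus12`), about `DH.MenuInformalConsistent` (E-18c), and
nothing about zeros of `L`-functions. [cite: Zhang2022LandauSiegel, §2 (2.32)–(2.33); §7 Prop 7.1 (7.2); §18 (18.9)–(18.12)] -/
theorem doneCondition_v11 :
    ClassDecided Rplusplus11 ∧
      ((∀ F ∈ bmultiWord6, F ∈ Rplusplus11) ∧ (∀ F ∈ blenWord3, F ∈ Rplusplus11)) ∧
      (DH.MenuConsistent ∧ DH.MenuConsistentPrimes) :=
  ⟨rplusplus11_decided, rplusplus11_words_sub, DH.menuConsistent_holds, DH.menuConsistentPrimes_holds⟩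

/-- Read-back of the new clause at a datum: for every modulus `D` with `log D ≥ 43 250` and every primitive quadratic
`χ ≠ 1` mod `D`, the model world `W(D, χ)` with its prime data satisfies the whole rendered PRIME menu —
`doneCondition_v11` instantiated, nothing more. [cite: Zhang2022LandauSiegel, §2 Assumption (A)] -/
theorem doneCondition_v11_primeMenu {D : ℕ} [NeZero D] (χ : DirichletCharacter ℂ D) (hprim : χ.IsPrimitive)
    (hquad : χ.IsQuadratic) (hne : χ ≠ 1) (hL : (43250 : ℝ) ≤ Real.log D) :
    DH.PrimeMenu (DH.world D χ) (DH.primeWorld D χ) :=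
  doneCondition_v11.2.2.2 D χ hprim hquad hne hL

/-! ### Version 12 — the §6 D1 OBJECT for the DONE-CONDITION line (ls-barrier-plan g1 rulings 2026-08-26T23:32:43Z (2),
23:56:27Z; inputs LANDED: `Repair.Rplusplus12` p477072 (class of record, 40 families, RepairRplusPlus5.lean), INTAKE-4
`Repair.bdetWord` p476156 (KILL(B-det)), INTAKE-3 `Repair.bfamWord` / `bfamWord_decided` p474295→p476369 (KILL(B-fam); REF-E
INTAKE-3 PASS 2026-08-27T00:10:14Z on v1.0.3), B-len intake v4 `Repair.blenWord4` p476079, E-18b `DH.menuConsistentPrimes_holds`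
p473947 (REF-E PASS), E-18c `DH.menuInformalConsistent_holds` p475376 (REF-E PASS as companion); append-only — `_v10`
(REF-E D1-1 PASS) and `_v11` (REF-E D1-1 ADDENDUM PASS 00:10:14Z) above stay as landed).

THE FIVE §B KILL WORDS OF RECORD AT THIS VERSION (stamps; BARRIER-STATE §3): B-multi director-frontier g5 2026-08-26T18:10:26Z
(AMENDED 18:15:06Z) · B-len ls-lead g0 19:19:33Z (director pre-authorisation 18:53:49Z) · B-dh director-frontier g6 19:31:07Z ·
B-fam director-frontier g6 WORD 20:55:00Z, OF RECORD 21:15:26Z · B-det director-frontier g6 23:09:45Z, §1a RE-SAID 23:27:01Z,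
REF-B1 (w1″) countersign 23:55:40Z («KILL(B-det) INSIDE DET … GIVEN det-E15 E-det-cone (E-102) on the continuum» — the
E-102 premise is DISPLAYED inside `Repair.bdetWord`'s families, decided nowhere here). B-ell: no word (live; §E in derivation
currency only). THE NOT-COVERED LEDGER of KILL-INTAKE §6 D2 is barrier/BARRIER-STATE.md §2′ items N1–N13, named here BY POINTER
ONLY; nothing in it is asserted or denied by `doneCondition_v12`. Shape of the decl = the planner's letter of 23:56:27Z
(B-fam is its OWN conjunct `ClassDecided bfamWord`, never a sub-list of `Rplusplus12` — INTAKE-3 rule; the B-len conjunct cites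
the intake of record v4 via `blenWord4_sub_rplusplus12`; the B-dh clause is the three-way conjunction on M_typed ∪ M_primes ∪ the
typed part of M_informal — `DH.MenuInformalCritLineConsistent` (p476879, E-18c part 2) is NOT a conjunct of this version). -/

/-- **THE DONE-CONDITION OF SUB-CELL E, version 12 (the §6 D1 decl of record for the DONE-CONDITION line).** The
conjunction of the kernel facts of record, each cited by name and nothing re-proved: (1) the class of record
`Rplusplus12` (40 design families fed to Zhang's main-term calculus or to a displayed model main term, p477072) is
DECIDED — every family's verdict «no closing of the §2/§18 endgame at main order without the DISPLAYED E*-strength input»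
holds on its whole class (`rplusplus12_decided`); (2) the intake lists of the THREE design-class KILL words are sub-lists of
`Rplusplus12`: `bmultiWord6` (B-multi), `blenWord4` (B-len, v4), `bdetWord` (B-det, «GIVEN E-102» displayed in its families)
(`rplusplus12_words_sub`, `blenWord4_sub_rplusplus12`); (3) the ENDGAME word B-fam: its own class `bfamWord` is DECIDED in
its own statuses ((I) by theorem, (II-a)/(II-b) GIVEN the displayed binders of record) — `bfamWord_decided`; (4) the
CONSISTENCY-MODEL word B-dh, UNCONDITIONAL on the whole kernel-typed menu: `DH.MenuConsistent` (p468827), `DH.MenuConsistentPrimes`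
(p473947) and `DH.MenuInformalConsistent` (p475376) hold BY THEOREM. Nothing is asserted about the not-covered ledger
(BARRIER-STATE §2′ N1–N13), about B-ell, or about zeros of `L`-functions; this is a statement about Zhang's METHOD AS
ARCHITECTED on the classes the five words killed. [cite: Zhang2022LandauSiegel, §2 (2.32)–(2.33); §7 Prop 7.1 (7.2); §18 (18.9)–(18.12)] -/
theorem doneCondition_v12 :
    ClassDecided Rplusplus12 ∧
      ((∀ F ∈ bmultiWord6, F ∈ Rplusplus12) ∧ (∀ F ∈ blenWord4, F ∈ Rplusplus12) ∧
        (∀ F ∈ bdetWord, F ∈ Rplusplus12)) ∧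
      ClassDecided bfamWord ∧
      (DH.MenuConsistent ∧ DH.MenuConsistentPrimes ∧ DH.MenuInformalConsistent) :=
  ⟨rplusplus12_decided,
    ⟨rplusplus12_words_sub.1, blenWord4_sub_rplusplus12, rplusplus12_words_sub.2.2⟩,
    bfamWord_decided,
    ⟨DH.menuConsistent_holds, DH.menuConsistentPrimes_holds, DH.menuInformalConsistent_holds⟩⟩

/-- Read-back of conjuncts (1)–(3): the four KILL-word intake classes are DECIDED classes — the three design-class words
inside `R⁺⁺` by monotonicity of `ClassDecided`, the endgame word in its own class — obtained from `doneCondition_v12`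
alone. [cite: Zhang2022LandauSiegel, §2 (2.32)–(2.33)] -/
theorem doneCondition_v12_words_decided :
    ClassDecided (bmultiWord6 ++ blenWord4 ++ bdetWord) ∧ ClassDecided bfamWord := by
  obtain ⟨hdec, ⟨hmulti, hlen, hdet⟩, hfam, -⟩ := doneCondition_v12
  refine ⟨fun F hF => ?_, hfam⟩
  rcases List.mem_append.mp hF with h | h
  · rcases List.mem_append.mp h with h' | h'
    · exact hdec F (hmulti F h')
    · exact hdec F (hlen F h')
  · exact hdec F (hdet F h)

/-! ### Version 13 — class of record `Rplusplus13`, LATEST intake words (ls-barrier-plan g1 rulings 2026-08-27T00:20:06Z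
«the decl quantifies over the LATEST words» and 00:33:33Z S-E-p5-7 «GO NOW: `doneCondition_v13` on `Rplusplus13` p478102
(44 families; rows 41–44 = the BandMV families p477819, CONDITIONAL on the E-004′ slot `Repair.BandMeanValue`) with
`rplusplus13_words_sub` over `bmultiWord6` / `blenWord4` / `bdetWord2` (INTAKE-4 Part 2 p477601; REF-E N1) + `bfamWord_decided` +
the three B-dh `_holds`»). Append-only: `_v10`, `_v11`, `_v12` above stay as landed (an earlier `_v13` draft on `Rplusplus12`
with a four-way B-dh block, p478872, was WITHDRAWN before verification in favour of this letter). Same five words and stamps as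
the Version-12 section; `_v14` later adds the B-ell intake `(∀ F ∈ bellWord, F ∈ Rplusplus14)` (INTAKE-5, word KILL(B-ell)
2026-08-27T00:20:49Z); `DH.MenuInformalCritLineConsistent` (p476879, E-18c part 2) is NOT a conjunct of this version.
Nothing of the NOT-COVERED LEDGER (BARRIER-STATE §2′ N1–N14) is asserted. -/

/-- **THE DONE-CONDITION OF SUB-CELL E, version 13 (§6 D1 object on the class of record `Rplusplus13`, latest intake
words).** The conjunction of landed kernel facts, each cited by name, nothing re-proved: (1) `Rplusplus13` (44 design
families, p478102) is DECIDED (`rplusplus13_decided`); (2) the LATEST intake lists of the three design-class KILL words are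
sub-lists of it — `bmultiWord6` (B-multi), `blenWord4` (B-len), `bdetWord2` (B-det, incl. `familyDetEntangled`; «GIVEN E-102»
displayed in the families) (`rplusplus13_words_sub`); (3) the endgame word B-fam: `bfamWord` DECIDED in its own class
(`bfamWord_decided`, INTAKE-3 bytes of record p477160); (4) the consistency-model word B-dh on the whole kernel-typed menu:
`DH.MenuConsistent` (p468827) ∧ `DH.MenuConsistentPrimes` (p473947) ∧ `DH.MenuInformalConsistent` (p475376) BY THEOREM.
Nothing is asserted about the not-covered ledger, about B-ell (INTAKE-5 pending → `_v14`), or about zeros of `L`-functions.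
[cite: Zhang2022LandauSiegel, §2 (2.32)–(2.33); §7 Prop 7.1 (7.2); §18 (18.9)–(18.12)] -/
theorem doneCondition_v13 :
    ClassDecided Rplusplus13 ∧
      ((∀ F ∈ bmultiWord6, F ∈ Rplusplus13) ∧ (∀ F ∈ blenWord4, F ∈ Rplusplus13) ∧
        (∀ F ∈ bdetWord2, F ∈ Rplusplus13)) ∧
      ClassDecided bfamWord ∧
      (DH.MenuConsistent ∧ DH.MenuConsistentPrimes ∧ DH.MenuInformalConsistent) :=
  ⟨rplusplus13_decided, rplusplus13_words_sub, bfamWord_decided,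
    ⟨DH.menuConsistent_holds, DH.menuConsistentPrimes_holds, DH.menuInformalConsistent_holds⟩⟩

/-- Read-back: the four KILL-word intake classes in their LATEST versions are DECIDED classes, from `doneCondition_v13`
alone. [cite: Zhang2022LandauSiegel, §2 (2.32)–(2.33)] -/
theorem doneCondition_v13_words_decided :
    ClassDecided (bmultiWord6 ++ blenWord4 ++ bdetWord2) ∧ ClassDecided bfamWord := by
  obtain ⟨hdec, ⟨hmulti, hlen, hdet⟩, hfam, -⟩ := doneCondition_v13
  refine ⟨fun F hF => ?_, hfam⟩
  rcases List.mem_append.mp hF with h | h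
  · rcases List.mem_append.mp h with h' | h'
    · exact hdec F (hmulti F h')
    · exact hdec F (hlen F h')
  · exact hdec F (hdet F h)


/-! ### Version 14 — class of record `Rplusplus14` with the B-ell intake (INTAKE-5 `Repair.bellWord`, p479175; word
KILL(B-ell) INSIDE D_ell, director-frontier g6 2026-08-27T00:20:49Z, GIVEN B-AH|_U ∧ hexp, riders R1/R2) — ls-barrier-plan g1
ruling 2026-08-27T00:33:33Z «`_v14` later adds `(∀ F ∈ bellWord, F ∈ Rplusplus14)`» and 00:43:27Z (1) (rows 45–49 =
`familyBellOnePiece` / `familyBellK0Plane` / `familyBellFirstOrder` / `familyBellCSEdge` / `familyBellSubcritical`; 45/46/49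
UNCONDITIONAL kind (b); 47 CONDITIONAL GIVEN `FirstOrderExpansion`; 48 CONDITIONAL GIVEN `CSExactExpansion`). Append-only;
`_v10`…`_v13` above stay as landed. THE SIX §B KILL WORDS OF RECORD AT THIS VERSION: the five of the Version-12 section + B-ell
director-frontier g6 2026-08-27T00:20:49Z (REF-B2 countersign of record 00:16:28Z over KILL-draft v0.7.3/v0.7.4; KILL-CERT(B-ell) v1
5625bef2660f98d2). §B = SIX KILLED-INTO-§E / ZERO LIVE. Nothing of the NOT-COVERED LEDGER (BARRIER-STATE §2′) is asserted; B-ell's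
premises (B-AH|_U, hexp, hexp_II owed) are DISPLAYED inside rows 47–48, decided nowhere here. -/

/-- **THE DONE-CONDITION OF SUB-CELL E, version 14 (§6 D1 object on the class of record `Rplusplus14`, all FOUR
design-class words intaken).** The conjunction of landed kernel facts, each cited by name, nothing re-proved: (1)
`Rplusplus14` (49 design families) is DECIDED (`rplusplus14_decided`); (2) the LATEST intake lists of the FOUR design-class
KILL words are sub-lists of it — `bmultiWord6` (B-multi), `blenWord4` (B-len), `bdetWord2` (B-det, «GIVEN E-102» displayed),
`bellWord` (B-ell, «GIVEN B-AH|_U ∧ hexp» displayed in rows 47–48) (`rplusplus14_words_sub`); (3) the endgame word B-fam: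
`bfamWord` DECIDED in its own class (`bfamWord_decided`); (4) the consistency-model word B-dh on the whole kernel-typed menu:
`DH.MenuConsistent` ∧ `DH.MenuConsistentPrimes` ∧ `DH.MenuInformalConsistent` BY THEOREM. Nothing is asserted about the
not-covered ledger or about zeros of `L`-functions. [cite: Zhang2022LandauSiegel, §2 (2.32)–(2.33); §7 Prop 7.1 (7.2); §18 (18.9)–(18.12)] -/
theorem doneCondition_v14 :
    ClassDecided Rplusplus14 ∧
      ((∀ F ∈ bmultiWord6, F ∈ Rplusplus14) ∧ (∀ F ∈ blenWord4, F ∈ Rplusplus14) ∧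
        (∀ F ∈ bdetWord2, F ∈ Rplusplus14) ∧ (∀ F ∈ bellWord, F ∈ Rplusplus14)) ∧
      ClassDecided bfamWord ∧
      (DH.MenuConsistent ∧ DH.MenuConsistentPrimes ∧ DH.MenuInformalConsistent) :=
  ⟨rplusplus14_decided, rplusplus14_words_sub, bfamWord_decided,
    ⟨DH.menuConsistent_holds, DH.menuConsistentPrimes_holds, DH.menuInformalConsistent_holds⟩⟩

/-- Read-back: the five KILL-word intake classes in their latest versions are DECIDED classes (the four design-class
words inside `R⁺⁺` by monotonicity, the endgame word in its own class), from `doneCondition_v14` alone.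
[cite: Zhang2022LandauSiegel, §2 (2.32)–(2.33)] -/
theorem doneCondition_v14_words_decided :
    ClassDecided (bmultiWord6 ++ blenWord4 ++ bdetWord2 ++ bellWord) ∧ ClassDecided bfamWord := by
  obtain ⟨hdec, ⟨hmulti, hlen, hdet, hell⟩, hfam, -⟩ := doneCondition_v14
  refine ⟨fun F hF => ?_, hfam⟩
  rcases List.mem_append.mp hF with h | h
  · rcases List.mem_append.mp h with h' | h'
    · rcases List.mem_append.mp h' with h'' | h''
      · exact hdec F (hmulti F h'')
      · exact hdec F (hlen F h'')
    · exact hdec F (hdet F h')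
  · exact hdec F (hell F h)

/-! ### Version 16 — class of record `Rplusplus16` (ls-barrier-plan g1 rulings 2026-08-27T01:22:18Z / 01:22:35Z S-E-p5-10
«file `doneCondition_v16` (same sentence over `Rplusplus16`) so OBJECT = CLASS again per the director's N3 principle; skip `_v15`»;
`Rplusplus16` p482146 = 54 families: rows 50–53 = the band-seam rows OF RECORD `…BandMVLip` (ls-barrier-p2 g3, p480299; CONDITIONAL
GIVEN E-004″(κ<6) `Repair.BandMeanValueLip`; rows 41–44 kept as landed implications, flagged not probative), row 54 =
`familyInPrintCeiling` (ls-barrier-p4 g3, p479134; THRESHOLD T-2′, NON-COVERING); coverage as v14/v15). Same four design-class words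
and the same B-fam / B-dh conjuncts as Version 14 (a `_v15` draft, p481442, was WITHDRAWN unverified in favour of this version).
Append-only; `_v10`…`_v14` above stay as landed. Outward sentence of record (director-frontier g6 01:16:31Z): the §E done-condition is
MET IN FORM modulo the ledger — GIVEN E-102; GIVEN E-014 ∧ E-022 (the two open discharge rows, displayed inside `bdetWord2`'s and
`bellWord`'s families, decided nowhere here). Nothing of the NOT-COVERED LEDGER (BARRIER-STATE §2′) is asserted. -/

/-- **THE DONE-CONDITION OF SUB-CELL E, version 16 (§6 D1 object on the class of record `Rplusplus16`, all FOUR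
design-class words intaken).** The conjunction of landed kernel facts, each cited by name, nothing re-proved: (1)
`Rplusplus16` (54 design families) is DECIDED (`rplusplus16_decided`); (2) the LATEST intake lists of the FOUR design-class
KILL words are sub-lists of it — `bmultiWord6` (B-multi), `blenWord4` (B-len), `bdetWord2` (B-det, «GIVEN E-102» displayed),
`bellWord` (B-ell, «GIVEN B-AH|_U ∧ hexp» displayed in rows 47–48) (`rplusplus16_words_sub`); (3) the endgame word B-fam:
`bfamWord` DECIDED in its own class (`bfamWord_decided`); (4) the consistency-model word B-dh on the whole kernel-typed menu:
`DH.MenuConsistent` ∧ `DH.MenuConsistentPrimes` ∧ `DH.MenuInformalConsistent` BY THEOREM. Nothing is asserted about the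
not-covered ledger or about zeros of `L`-functions. [cite: Zhang2022LandauSiegel, §2 (2.32)–(2.33); §7 Prop 7.1 (7.2); §18 (18.9)–(18.12)] -/
theorem doneCondition_v16 :
    ClassDecided Rplusplus16 ∧
      ((∀ F ∈ bmultiWord6, F ∈ Rplusplus16) ∧ (∀ F ∈ blenWord4, F ∈ Rplusplus16) ∧
        (∀ F ∈ bdetWord2, F ∈ Rplusplus16) ∧ (∀ F ∈ bellWord, F ∈ Rplusplus16)) ∧
      ClassDecided bfamWord ∧
      (DH.MenuConsistent ∧ DH.MenuConsistentPrimes ∧ DH.MenuInformalConsistent) :=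
  ⟨rplusplus16_decided, rplusplus16_words_sub, bfamWord_decided,
    ⟨DH.menuConsistent_holds, DH.menuConsistentPrimes_holds, DH.menuInformalConsistent_holds⟩⟩

/-- Read-back: the five KILL-word intake classes in their latest versions are DECIDED classes (the four design-class
words inside `R⁺⁺` by monotonicity, the endgame word in its own class), from `doneCondition_v16` alone.
[cite: Zhang2022LandauSiegel, §2 (2.32)–(2.33)] -/
theorem doneCondition_v16_words_decided :
    ClassDecided (bmultiWord6 ++ blenWord4 ++ bdetWord2 ++ bellWord) ∧ ClassDecided bfamWord := by
  obtain ⟨hdec, ⟨hmulti, hlen, hdet, hell⟩, hfam, -⟩ := doneCondition_v16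
  refine ⟨fun F hF => ?_, hfam⟩
  rcases List.mem_append.mp hF with h | h
  · rcases List.mem_append.mp h with h' | h'
    · rcases List.mem_append.mp h' with h'' | h''
      · exact hdec F (hmulti F h'')
      · exact hdec F (hlen F h'')
    · exact hdec F (hdet F h')
  · exact hdec F (hell F h)

/-! ### Version 17 — class of record `Rplusplus17` (57 families, p496717) AND «GIVEN E-102» DISCHARGED IN THE KERNEL
(`Det.edetPremise_unit`, p496401): object = class per the director's N3 principle; filed by the v17 class-book filer
(ls-barrier-p6 g3, 2026-08-27; p1 WAKE absorbed, director-frontier g7 04:32:25Z (4)). Rows 55–57 of `Rplusplus17` are the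
UNCONDITIONAL shift-detector rows (one-sided `familyDetShiftUncond` p494868; glued any-overlap `familyDetGluedUncond` p495442;
glued no-overlap `familyDetGluedSepUncond` p495794). New conjunct (5): E-102 IN FULL — `Det.EdetPremise (Ioo 0 1) (Ioo 0 5)`
(entangled cone ∧ monomial cone) — is a THEOREM (`Det.edetPremise_unit`, ls-barrier-p2 g4, with `Det.monomialConePSD_unit`
p490608 and `Det.edetCone_unit`), so `bdetWord2`'s displayed premise is discharged: its two conditional rows read outright
(`Repair.bdet2_verdicts_of_edetPremise Det.edetPremise_unit`; slot-free row object → version 18, ls-Bdet-typer-2 g3).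
Outward sentence (for ls-barrier-plan g2 to word): the §E done-condition is MET IN FORM modulo the ledger — GIVEN E-014 ∧ E-022
only (displayed inside `bellWord`'s rows 47–48, decided nowhere here); E-102 is no longer a «GIVEN». Append-only; `_v10`…`_v16`
above stay as landed. Nothing of the NOT-COVERED LEDGER is asserted; nothing about zeros of `L`-functions. -/

/-- **THE DONE-CONDITION OF SUB-CELL E, version 17 (§6 D1 object on the class of record `Rplusplus17`; E-102 discharged).**
The conjunction of landed kernel facts, each cited by name, nothing re-proved: (1) `Rplusplus17` (57 design families) is
DECIDED (`rplusplus17_decided`); (2) the LATEST intake lists of the FOUR design-class KILL words are sub-lists of it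
(`rplusplus17_words_sub`); (3) the endgame word B-fam: `bfamWord` DECIDED in its own class (`bfamWord_decided`); (4) the
consistency-model word B-dh on the whole kernel-typed menu BY THEOREM; (5) **E-102 in full is a theorem**:
`Det.EdetPremise (Set.Ioo 0 1) (Set.Ioo 0 5)` (`Det.edetPremise_unit`) — the premise displayed by `bdetWord2`.
[cite: Zhang2022LandauSiegel, §2 (2.32)–(2.33); §7 Prop 7.1 (7.2), (7.19)–(7.21); §18 (18.9)–(18.12)] -/
theorem doneCondition_v17 :
    ClassDecided Rplusplus17 ∧
      ((∀ F ∈ bmultiWord6, F ∈ Rplusplus17) ∧ (∀ F ∈ blenWord4, F ∈ Rplusplus17) ∧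
        (∀ F ∈ bdetWord2, F ∈ Rplusplus17) ∧ (∀ F ∈ bellWord, F ∈ Rplusplus17)) ∧
      ClassDecided bfamWord ∧
      (DH.MenuConsistent ∧ DH.MenuConsistentPrimes ∧ DH.MenuInformalConsistent) ∧
      Det.EdetPremise (Set.Ioo 0 1) (Set.Ioo 0 5) :=
  ⟨rplusplus17_decided, rplusplus17_words_sub, bfamWord_decided,
    ⟨DH.menuConsistent_holds, DH.menuConsistentPrimes_holds, DH.menuInformalConsistent_holds⟩, Det.edetPremise_unit⟩

/-- Read-back: the five KILL-word intake classes in their latest versions are DECIDED classes, and the B-det word's two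
conditional rows read OUTRIGHT (E-102 discharged), from `doneCondition_v17` and `bdet2_verdicts_of_edetPremise`.
[cite: Zhang2022LandauSiegel, §2 (2.16), (2.18), (2.32)–(2.33); §7 Prop 7.1 (7.2)] -/
theorem doneCondition_v17_words_decided :
    (ClassDecided (bmultiWord6 ++ blenWord4 ++ bdetWord2 ++ bellWord) ∧ ClassDecided bfamWord) ∧
      ((∀ d : DetShiftDesign, KBdet (.w2 d) →
          ¬ (Det.FormDet (Det.shiftRecipe d.b) d.u d.u' * Det.FormDet (Det.shiftRecipe d.b) d.f d.f'
              < ‖Det.FormDetPolar (Det.shiftRecipe d.b) d.u d.u' d.f d.f'‖ ^ 2)) ∧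
        ∀ e : DetEntangledDesign, KBdet2 (.entangled e) → ¬ ((Det.entangledMain e.a e.b e.h e.h').re < 0)) := by
  obtain ⟨hdec, ⟨hmulti, hlen, hdet, hell⟩, hfam, -, hE⟩ := doneCondition_v17
  refine ⟨⟨fun F hF => ?_, hfam⟩, bdet2_verdicts_of_edetPremise hE⟩
  rcases List.mem_append.mp hF with h | h
  · rcases List.mem_append.mp h with h' | h'
    · rcases List.mem_append.mp h' with h'' | h''
      · exact hdec F (hmulti F h'')
      · exact hdec F (hlen F h'')
    · exact hdec F (hdet F h')
  · exact hdec F (hell F h)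

end Repair

end Literature.NumberTheory.LFunctions.Zhang2022

end
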